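import Mathlib
import Summits.PneNP.PneNP.Theorems.KarlinRubinMonotoneSufficesStubShiftCount

/-!
# Crux `MonotoneSuffices` (stmt-PneNP-18026), line `Sketch` — mixture-shift rung, stub
# `stub_mixtureCount` (M1): the law of the up-shift by a mixture of shift sets

On the cube `α → Bool` (`supp x = {a | x a}`) the UP-SHIFT by a set `R` is
`x ↦ x ∨ 1_R = fun a => x a || [a ∈ R]`.  The density-shift rung used uniformly random `r`-sets `R`;
here `R` ranges over an ARBITRARY finite family `Rs` (a mixture of shifts).  Double counting the
pairs `(x, R)`, `R ∈ Rs`, whose shift lands in `A`: for each fixed `R` the shift is `2^{#R}`-to-one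
onto the vectors `y` with `R ⊆ supp y` (`shiftCount_card_filter_shift_mem`), so

* `stub_mixtureCount` — `∑_{R ∈ Rs} #{x | x ∨ 1_R ∈ A} = ∑_{y ∈ A} ∑_{R ∈ Rs, R ⊆ supp y} 2^{#R}`.
-/

set_option linter.dupNamespace false -- `Summit.PneNP.PneNP.…`: summit = sub-problem name (D-0017)

namespace Summit.PneNP.PneNP.Theorems.MonotoneSuffices.DensityShift

open Finset

/-- **M1, the law of the mixture of up-shifts** (registered stub of stmt-PneNP-18026, line `Sketch`,
mixture-shift rung): for a finite family `Rs` of shift sets, the pairs `(x, R)`, `R ∈ Rs`, with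
`x ∨ 1_R ∈ A` number `∑_{y ∈ A} ∑_{R ∈ Rs, R ⊆ supp y} 2^{#R}`, since the shift by a fixed `R` is
`2^{#R}`-to-one onto the vectors containing `R`. [folklore] -/
theorem stub_mixtureCount :
    ∀ {α : Type*} [Fintype α] [DecidableEq α] (Rs : Finset (Finset α)) (A : Finset (α → Bool)),
      ∑ R ∈ Rs,
          #((univ : Finset (α → Bool)).filter fun x => (fun a => x a || decide (a ∈ R)) ∈ A) =
        ∑ y ∈ A, ∑ R ∈ Rs.filter (fun R => R ⊆ univ.filter fun a => y a = true), 2 ^ #R := by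
  intro α _ _ Rs A
  calc ∑ R ∈ Rs,
          #((univ : Finset (α → Bool)).filter fun x => (fun a => x a || decide (a ∈ R)) ∈ A)
      = ∑ R ∈ Rs, ∑ y ∈ A, if R ⊆ univ.filter (fun a => y a = true) then 2 ^ #R else 0 := by
        refine sum_congr rfl fun R _ => ?_
        rw [shiftCount_card_filter_shift_mem, card_filter, mul_sum]
        refine sum_congr rfl fun y _ => ?_
        rw [mul_ite, mul_one, mul_zero]
    _ = ∑ y ∈ A, ∑ R ∈ Rs, if R ⊆ univ.filter (fun a => y a = true) then 2 ^ #R else 0 :=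
        sum_comm
    _ = ∑ y ∈ A, ∑ R ∈ Rs.filter (fun R => R ⊆ univ.filter fun a => y a = true), 2 ^ #R := by
        refine sum_congr rfl fun y _ => ?_
        rw [sum_filter]

end Summit.PneNP.PneNP.Theorems.MonotoneSuffices.DensityShift
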